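import Summits.RiemannHypothesis.RiemannHypothesis.Theorems.SuzukiStructureFunctionsZetaDynamics
import Summits.RiemannHypothesis.RiemannHypothesis.Theorems.SuzukiStructureFunctionsExtendedSystem
import Literature.NumberTheory.LFunctions.SuzukiSingleOperatorKernelDerivProofs
import Mathlib.Analysis.SpecialFunctions.JapaneseBracket
import Mathlib.Analysis.Calculus.ContDiff.Deriv
import HarnessLib

/-!
# SuzukiStructureFunctionsZetaRegularity — `Cⁿ`-regularity of line inverse Fourier transforms from polynomial decay;
# `ϱ_ζ^{ω,ν} ∈ C^∞(ℝ)`, `K_ζ^{ω,ν} ∈ C^k(ℝ)` for `νω > k+1`, (K4) for `νω > 2`; the `ζ` canonical system of Thm. 2.2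
# unconditionally on `(−∞,0)` and on `(0,τ)` MODULO the typed residual (column DBR; RH-FREE)

LINE 1 — LABEL: RH-FREE (dominated differentiation under absolutely convergent line integrals; the only `ζ` input is the
classical decay of `ξ` on vertical strips and of `Θ` on `Im z = 1 + ω > ½ + ω`, i.e. the zero-free half-plane `Re s > 1`);
bears_on LADDER-RH B-D → B-P(P1)/(P3): it verifies, for the `ζ` data `(ϱ_ζ^{ω,ν}, K_ζ^{ω,ν})`, the two regularity
hypotheses `ContDiff ℝ 1 ϱ` ((K1)) and `IsPiecewiseC1 K` ((K4)) of the typed residual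
`SuzukiStructure.Suzuki2021_thm31_dynamics`, so that — MODULO that named fact, which is NOT proved here — Thm. 2.2's
canonical system for `(A_ζ, B_ζ)` follows (`solvesCanonicalSystemOn_zeta_of_thm31`, CONDITIONAL); on `(−∞,0)` it is
unconditional (`solvesCanonicalSystemOn_zeta_Iio`).
WHAT THIS IS NOT: not progress toward RH; Thm. 3.1 (4) (the canonical system on the clean range) is NOT proved — it is
consumed as the hypothesis `hfact` in exactly one, explicitly CONDITIONAL theorem; `E_ζ(t,·) ∈ ℍ𝔹̄` / Thm. 2.4 untouched.

Source: M. Suzuki, J. Funct. Anal. 281 (2021) 109116 = arXiv:1606.05726 [Suzuki2021Hamiltonians], Lemma 4.1 ((K1) for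
`E_ζ^{ω,ν}`), Prop. 4.1 (6) and last assertion («if `νωd_L > k+1` … `K_L^{ω,ν}` belongs to `C^k(ℝ)`»), Thm. 2.2.

Contents (seat rh-dbr-eng-5 g7): generic — `norm_real_add_mul_I_le`, `norm_pow_mul_symbol_le`,
`integrable_one_add_abs_pow_mul_rpow`, `integrable_weight_pow_mul_symbol`, `integrable_pow_mul_symbol_lineIntegrand`,
`hasDerivAt_invFourierLine_pow`, `contDiff_invFourierLine_pow`, **`contDiff_invFourierLine_of_decay`**,
`hasDerivAt_invFourierLine_of_decay`, `one_add_abs_pow_mul_exp_neg_le`; `ζ` — `continuous_suzukiTheta_line`,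
**`contDiff_suzukiKernel`**, `hasDerivAt_suzukiKernel`, **`isPiecewiseC1_suzukiKernel`**, `exists_norm_suzukiE_line_le_rpow`,
`continuous_suzukiE_line`, **`contDiff_suzukiRho`**, `contDiff_infty_suzukiRho`, `hasDerivAt_suzukiRho`,
`solvesCanonicalSystemOn_zeta_Iio`, `solvesCanonicalSystemOn_zeta_of_thm31` (CONDITIONAL on the residual).
-/

noncomputable section

-- D-0017: `Summit.<S>.<S>.…` is the designed namespace of a single-problem summit.
set_option linter.dupNamespace false

open MeasureTheory Set Filter Topology Function Complex
open scoped Real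

namespace Summit.RiemannHypothesis.RiemannHypothesis.Theorems.SuzukiStructureFunctions

open Literature.NumberTheory.LFunctions Literature.NumberTheory.LFunctions.SuzukiStructure
open Literature.NumberTheory.LFunctions.Suzuki2020Deriv (hasDerivAt_invFourierLine)

/-! ## §23 `Cⁿ`-regularity of inverse Fourier transforms along a line from polynomial decay of the symbol;
for `ζ`: `ϱ_ζ^{ω,ν} ∈ C^∞(ℝ)` ((K1)), `K_ζ^{ω,ν} ∈ C^k(ℝ)` for `νω > k+1` (Prop. 4.1, last assertion), (K4) for
`νω > 2`, and the canonical system of Thm. 2.2 MODULO the typed residual `Suzuki2021_thm31_dynamics` -/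

section LineDecay

variable {Φ : ℂ → ℂ} {c C r : ℝ}

/-- RH-FREE. `‖u + ic‖ ≤ (1 + c)(1 + |u|)` for `c ≥ 0`. -/
theorem norm_real_add_mul_I_le (hc : 0 ≤ c) (u : ℝ) : ‖(u : ℂ) + (c : ℂ) * I‖ ≤ (1 + c) * (1 + |u|) := by
  calc ‖(u : ℂ) + (c : ℂ) * I‖ ≤ ‖(u : ℂ)‖ + ‖(c : ℂ) * I‖ := norm_add_le _ _
    _ = |u| + c := by
        rw [norm_mul, Complex.norm_I, mul_one, Complex.norm_real, Complex.norm_real, Real.norm_eq_abs,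
          Real.norm_eq_abs, abs_of_nonneg hc]
    _ ≤ (1 + c) * (1 + |u|) := by nlinarith [abs_nonneg u, mul_nonneg hc (abs_nonneg u)]

/-- RH-FREE. Pointwise bound for the weighted symbols `(−iz)^j Φ(z)` on the line `Im z = c` under
`‖Φ(u+ic)‖ ≤ C(1+|u|)^{−r}`: `‖(−iz)^jΦ(z)‖ ≤ C(1+c)^j (1+|u|)^j (1+|u|)^{−r}`. -/
theorem norm_pow_mul_symbol_le (hc : 0 ≤ c)
    (hC : ∀ u : ℝ, ‖Φ ((u : ℂ) + (c : ℂ) * I)‖ ≤ C * (1 + |u|) ^ (-r)) (j : ℕ) (u : ℝ) :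
    ‖(-I * ((u : ℂ) + (c : ℂ) * I)) ^ j * Φ ((u : ℂ) + (c : ℂ) * I)‖ ≤
      C * (1 + c) ^ j * ((1 + |u|) ^ j * (1 + |u|) ^ (-r)) := by
  rw [norm_mul, norm_pow, norm_mul, norm_neg, Complex.norm_I, one_mul]
  have h1 : ‖(u : ℂ) + (c : ℂ) * I‖ ^ j ≤ ((1 + c) * (1 + |u|)) ^ j :=
    pow_le_pow_left₀ (norm_nonneg _) (norm_real_add_mul_I_le hc u) j
  calc ‖(u : ℂ) + (c : ℂ) * I‖ ^ j * ‖Φ ((u : ℂ) + (c : ℂ) * I)‖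
      ≤ ((1 + c) * (1 + |u|)) ^ j * (C * (1 + |u|) ^ (-r)) :=
        mul_le_mul h1 (hC u) (norm_nonneg _) (by positivity)
    _ = C * (1 + c) ^ j * ((1 + |u|) ^ j * (1 + |u|) ^ (-r)) := by rw [mul_pow]; ring

/-- RH-FREE. `(1+|u|)^j (1+|u|)^{−r}` is integrable on `ℝ` when `r > j + 1` (Japanese bracket). -/
theorem integrable_one_add_abs_pow_mul_rpow (j : ℕ) (hr : (j : ℝ) + 1 < r) :
    Integrable fun u : ℝ => (1 + |u|) ^ j * (1 + |u|) ^ (-r) := by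
  have h := integrable_one_add_norm (E := ℝ) (μ := volume) (r := r - j)
    (by simp only [Module.finrank_self, Nat.cast_one]; linarith)
  refine h.congr (Eventually.of_forall fun u => ?_)
  have hu : 0 < 1 + |u| := by positivity
  simp only [Real.norm_eq_abs]
  rw [← Real.rpow_natCast, ← Real.rpow_add hu]
  congr 1
  ring

/-- RH-FREE. Weighted integrability `(1+|u|)‖(−iz)^jΦ(z)‖ ∈ L¹(du)` on the line when `r > j + 2`. -/
theorem integrable_weight_pow_mul_symbol (hc : 0 ≤ c)
    (hcont : Continuous fun u : ℝ => Φ ((u : ℂ) + (c : ℂ) * I))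
    (hC : ∀ u : ℝ, ‖Φ ((u : ℂ) + (c : ℂ) * I)‖ ≤ C * (1 + |u|) ^ (-r)) (j : ℕ) (hr : (j : ℝ) + 2 < r) :
    Integrable fun u : ℝ =>
      (1 + |u|) * ‖(-I * ((u : ℂ) + (c : ℂ) * I)) ^ j * Φ ((u : ℂ) + (c : ℂ) * I)‖ := by
  have hint := (integrable_one_add_abs_pow_mul_rpow (r := r) (j + 1) (by push_cast; linarith)).const_mul
    (C * (1 + c) ^ j)
  refine hint.mono' ?_ (Eventually.of_forall fun u => ?_)
  · exact ((by fun_prop : Continuous fun u : ℝ => 1 + |u|).mul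
      ((((by fun_prop : Continuous fun u : ℝ => -I * ((u : ℂ) + (c : ℂ) * I)).pow j).mul
        hcont).norm)).aestronglyMeasurable
  · have hu : 0 ≤ 1 + |u| := by positivity
    rw [Real.norm_eq_abs, abs_of_nonneg (by positivity)]
    calc (1 + |u|) * ‖(-I * ((u : ℂ) + (c : ℂ) * I)) ^ j * Φ ((u : ℂ) + (c : ℂ) * I)‖
        ≤ (1 + |u|) * (C * (1 + c) ^ j * ((1 + |u|) ^ j * (1 + |u|) ^ (-r))) :=
          mul_le_mul_of_nonneg_left (norm_pow_mul_symbol_le hc hC j u) hu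
      _ = C * (1 + c) ^ j * ((1 + |u|) ^ (j + 1) * (1 + |u|) ^ (-r)) := by ring

/-- RH-FREE. Integrability of the line integrand `(−iz)^jΦ(z)e^{−izx}` (`z = u + ic`) when `r > j + 1`. -/
theorem integrable_pow_mul_symbol_lineIntegrand (hc : 0 ≤ c)
    (hcont : Continuous fun u : ℝ => Φ ((u : ℂ) + (c : ℂ) * I))
    (hC : ∀ u : ℝ, ‖Φ ((u : ℂ) + (c : ℂ) * I)‖ ≤ C * (1 + |u|) ^ (-r)) (j : ℕ) (hr : (j : ℝ) + 1 < r)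
    (x : ℝ) :
    Integrable fun u : ℝ => (-I * ((u : ℂ) + (c : ℂ) * I)) ^ j * Φ ((u : ℂ) + (c : ℂ) * I) *
      cexp (-I * ((u : ℂ) + (c : ℂ) * I) * (x : ℂ)) := by
  have hint := (integrable_one_add_abs_pow_mul_rpow (r := r) j hr).const_mul
    (C * (1 + c) ^ j * Real.exp (c * x))
  refine hint.mono' ?_ (Eventually.of_forall fun u => ?_)
  · exact ((((by fun_prop : Continuous fun u : ℝ => -I * ((u : ℂ) + (c : ℂ) * I)).pow j).mul hcont).mul
      (by fun_prop)).aestronglyMeasurable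
  · rw [norm_mul, norm_cexp_neg_I_line]
    calc ‖(-I * ((u : ℂ) + (c : ℂ) * I)) ^ j * Φ ((u : ℂ) + (c : ℂ) * I)‖ * Real.exp (c * x)
        ≤ C * (1 + c) ^ j * ((1 + |u|) ^ j * (1 + |u|) ^ (-r)) * Real.exp (c * x) :=
          mul_le_mul_of_nonneg_right (norm_pow_mul_symbol_le hc hC j u) (Real.exp_pos _).le
      _ = C * (1 + c) ^ j * Real.exp (c * x) * ((1 + |u|) ^ j * (1 + |u|) ^ (-r)) := by ring

/-- RH-FREE. **Differentiation under the line integral, iterated form:** for `r > j + 2` the transform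
`x ↦ (2π)⁻¹∫(−iz)^jΦ(z)e^{−izx}dz` (`Im z = c ≥ 0`) has derivative the `(j+1)`-st weighted transform
(the tree's `hasDerivAt_invFourierLine`, weight `(1+|u|)‖·‖ ∈ L¹`). -/
theorem hasDerivAt_invFourierLine_pow (hc : 0 ≤ c)
    (hcont : Continuous fun u : ℝ => Φ ((u : ℂ) + (c : ℂ) * I))
    (hC : ∀ u : ℝ, ‖Φ ((u : ℂ) + (c : ℂ) * I)‖ ≤ C * (1 + |u|) ^ (-r)) (j : ℕ) (hr : (j : ℝ) + 2 < r)
    (x : ℝ) :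
    HasDerivAt (fun y : ℝ => invFourierLine (fun z : ℂ => (-I * z) ^ j * Φ z) c y)
      (invFourierLine (fun z : ℂ => (-I * z) ^ (j + 1) * Φ z) c x) x := by
  have hcj : Continuous fun u : ℝ => (-I * ((u : ℂ) + (c : ℂ) * I)) ^ j * Φ ((u : ℂ) + (c : ℂ) * I) :=
    ((by fun_prop : Continuous fun u : ℝ => -I * ((u : ℂ) + (c : ℂ) * I)).pow j).mul hcont
  have h := hasDerivAt_invFourierLine (Φ := fun z : ℂ => (-I * z) ^ j * Φ z) hc hcj
    (integrable_weight_pow_mul_symbol hc hcont hC j hr) x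
  have e : (fun z : ℂ => -I * z * ((-I * z) ^ j * Φ z)) = fun z : ℂ => (-I * z) ^ (j + 1) * Φ z := by
    funext z; ring
  rw [e] at h
  exact h

/-- RH-FREE. **`Cⁿ` from decay of order `r > j + n + 1`** for the `j`-weighted transforms (induction on `n`:
continuity by dominated convergence, the successor step by `hasDerivAt_invFourierLine_pow`). -/
theorem contDiff_invFourierLine_pow (hc : 0 ≤ c)
    (hcont : Continuous fun u : ℝ => Φ ((u : ℂ) + (c : ℂ) * I))
    (hC : ∀ u : ℝ, ‖Φ ((u : ℂ) + (c : ℂ) * I)‖ ≤ C * (1 + |u|) ^ (-r)) (n : ℕ) :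
    ∀ j : ℕ, (j : ℝ) + n + 1 < r →
      ContDiff ℝ n (fun y : ℝ => invFourierLine (fun z : ℂ => (-I * z) ^ j * Φ z) c y) := by
  induction n with
  | zero =>
    intro j hj
    push_cast at hj
    exact contDiff_zero.2 (continuous_invFourierLine hc
      (integrable_pow_mul_symbol_lineIntegrand hc hcont hC j (by linarith) ))
  | succ n ih =>
    intro j hj
    push_cast at hj
    rw [Nat.cast_succ, contDiff_succ_iff_deriv]
    have hd := fun x => hasDerivAt_invFourierLine_pow hc hcont hC j (by linarith) x
    refine ⟨fun x => (hd x).differentiableAt, fun h => absurd h (WithTop.natCast_ne_top n), ?_⟩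
    have e : deriv (fun y : ℝ => invFourierLine (fun z : ℂ => (-I * z) ^ j * Φ z) c y) =
        fun y : ℝ => invFourierLine (fun z : ℂ => (-I * z) ^ (j + 1) * Φ z) c y := by
      funext x; exact (hd x).deriv
    rw [e]
    exact ih (j + 1) (by push_cast; linarith)

/-- **RH-FREE · inverse Fourier transforms along a line of symbols with polynomial decay of order `r > n + 1` are
`Cⁿ`:** if `u ↦ Φ(u+ic)` is continuous (`c ≥ 0`) and `‖Φ(u+ic)‖ ≤ C(1+|u|)^{−r}` with `r > n+1`, then
`x ↦ (2π)⁻¹∫_{Im z=c} Φ(z)e^{−izx}dz ∈ Cⁿ(ℝ)` — the mechanism of [Su21, Prop. 4.1, last assertion]. -/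
theorem contDiff_invFourierLine_of_decay (hc : 0 ≤ c)
    (hcont : Continuous fun u : ℝ => Φ ((u : ℂ) + (c : ℂ) * I))
    (hC : ∀ u : ℝ, ‖Φ ((u : ℂ) + (c : ℂ) * I)‖ ≤ C * (1 + |u|) ^ (-r)) {n : ℕ} (hn : (n : ℝ) + 1 < r) :
    ContDiff ℝ n (fun y : ℝ => invFourierLine Φ c y) := by
  have h := contDiff_invFourierLine_pow hc hcont hC n 0 (by push_cast; linarith)
  have e : (fun z : ℂ => (-I * z) ^ 0 * Φ z) = Φ := by funext z; simp
  rwa [e] at h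

/-- RH-FREE. First-derivative formula under decay of order `r > 2`:
`(d/dx)(2π)⁻¹∫Φ(z)e^{−izx}dz = (2π)⁻¹∫(−iz)Φ(z)e^{−izx}dz` on `Im z = c`. -/
theorem hasDerivAt_invFourierLine_of_decay (hc : 0 ≤ c)
    (hcont : Continuous fun u : ℝ => Φ ((u : ℂ) + (c : ℂ) * I))
    (hC : ∀ u : ℝ, ‖Φ ((u : ℂ) + (c : ℂ) * I)‖ ≤ C * (1 + |u|) ^ (-r)) (hr : 2 < r) (x : ℝ) :
    HasDerivAt (fun y : ℝ => invFourierLine Φ c y) (invFourierLine (fun z : ℂ => -I * z * Φ z) c x) x := by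
  have h := hasDerivAt_invFourierLine_pow hc hcont hC 0 (by push_cast; linarith) x
  have e0 : (fun z : ℂ => (-I * z) ^ 0 * Φ z) = Φ := by funext z; simp
  have e1 : (fun z : ℂ => (-I * z) ^ (0 + 1) * Φ z) = fun z : ℂ => -I * z * Φ z := by funext z; simp
  rw [e0, e1] at h
  exact h

/-- RH-FREE. Polynomial weights against exponential decay: `(1+|u|)^m e^{−a|u|} ≤ m!·a^{−m}·e^{a}` (`a > 0`;
from `Xᵐ/m! ≤ eˣ` at `X = a(1+|u|)`). -/
theorem one_add_abs_pow_mul_exp_neg_le {a : ℝ} (ha : 0 < a) (m : ℕ) (u : ℝ) :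
    (1 + |u|) ^ m * Real.exp (-a * |u|) ≤ m.factorial * a⁻¹ ^ m * Real.exp a := by
  set X : ℝ := a * (1 + |u|) with hX
  have hX0 : 0 ≤ X := by positivity
  have hfac : (0 : ℝ) < m.factorial := by positivity
  have h1 : X ^ m / m.factorial ≤ Real.exp X := Real.pow_div_factorial_le_exp X hX0 m
  have h2 : X ^ m ≤ m.factorial * Real.exp X := by
    rw [div_le_iff₀ hfac] at h1; linarith
  have hXexp : Real.exp X = Real.exp a * Real.exp (a * |u|) := by
    rw [hX, mul_add, mul_one, Real.exp_add]
  have hapow : X ^ m = a ^ m * (1 + |u|) ^ m := by rw [hX, mul_pow]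
  rw [hXexp, hapow] at h2
  have hexp : 0 < Real.exp (a * |u|) := Real.exp_pos _
  have hapos : 0 < a ^ m := pow_pos ha m
  rw [show -a * |u| = -(a * |u|) by ring, Real.exp_neg, inv_pow]
  rw [show (1 + |u|) ^ m * (Real.exp (a * |u|))⁻¹ = (a ^ m * (1 + |u|) ^ m) / (a ^ m * Real.exp (a * |u|)) by
    field_simp]
  rw [div_le_iff₀ (by positivity)]
  calc a ^ m * (1 + |u|) ^ m ≤ m.factorial * (Real.exp a * Real.exp (a * |u|)) := h2
    _ = m.factorial * (a ^ m)⁻¹ * Real.exp a * (a ^ m * Real.exp (a * |u|)) := by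
        field_simp

end LineDecay

/-! ### `K_ζ^{ω,ν} ∈ C^k(ℝ)` for `νω > k + 1`; (K4) for `νω > 2` -/

/-- RH-FREE. `u ↦ Θ_ζ^{ω,ν}(u + i(1+ω))` is continuous (`Θ` is holomorphic on `Im z ≥ ½ − ω`; `ω ≥ 0`). -/
theorem continuous_suzukiTheta_line {ω : ℝ} (hω : 0 ≤ ω) (ν : ℕ) :
    Continuous fun u : ℝ => suzukiTheta ω ν ((u : ℂ) + ((1 + ω : ℝ) : ℂ) * I) :=
  (differentiableOn_suzukiTheta ω ν).continuousOn.comp_continuous (by fun_prop) fun u => by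
    simp only [mem_setOf_eq, Complex.add_im, Complex.ofReal_im, Complex.mul_im, Complex.ofReal_re,
      Complex.I_im, Complex.I_re, mul_one, mul_zero, add_zero, zero_add]
    linarith

/-- **RH-FREE · [Su21, Prop. 4.1, last assertion] for `ζ` (`d_ζ = 1`): `K_ζ^{ω,ν} ∈ C^k(ℝ)` whenever
`νω > k + 1`** (`ω > 0`): the symbol `Θ` decays like `(1+|u|)^{−νω}` on `Im z = 1 + ω`
(`norm_suzukiTheta_line_le`), so `k` differentiations under the integral are dominated. -/
theorem contDiff_suzukiKernel {ω : ℝ} (hω : 0 < ω) {ν k : ℕ} (hk : (k : ℝ) + 1 < ν * ω) :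
    ContDiff ℝ k (suzukiKernel ω ν) := by
  obtain ⟨C, _, hC⟩ := norm_suzukiTheta_line_le hω ν (v₀ := 1 + ω) (by linarith)
  have h := contDiff_invFourierLine_of_decay (Φ := suzukiTheta ω ν) (c := 1 + ω) (by linarith)
    (continuous_suzukiTheta_line hω.le ν) (fun u => hC (1 + ω) le_rfl u) hk
  have e : suzukiKernel ω ν = fun x => Complex.reCLM (invFourierLine (suzukiTheta ω ν) (1 + ω) x) := by
    funext x; rfl
  rw [e]
  exact Complex.reCLM.contDiff.comp h

/-- RH-FREE. **Derivative formula for `νω > 2`:** `K_ζ′(x) = Re (2π)⁻¹∫_{Im z = 1+ω} (−iz)Θ(z)e^{−izx}dz` at every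
real `x`. -/
theorem hasDerivAt_suzukiKernel {ω : ℝ} (hω : 0 < ω) {ν : ℕ} (h2 : 2 < (ν : ℝ) * ω) (x : ℝ) :
    HasDerivAt (suzukiKernel ω ν)
      (invFourierLine (fun z : ℂ => -I * z * suzukiTheta ω ν z) (1 + ω) x).re x := by
  obtain ⟨C, _, hC⟩ := norm_suzukiTheta_line_le hω ν (v₀ := 1 + ω) (by linarith)
  have h := hasDerivAt_invFourierLine_of_decay (Φ := suzukiTheta ω ν) (c := 1 + ω) (by linarith)
    (continuous_suzukiTheta_line hω.le ν) (fun u => hC (1 + ω) le_rfl u) h2 x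
  have e : suzukiKernel ω ν = fun x => Complex.reCLM (invFourierLine (suzukiTheta ω ν) (1 + ω) x) := by
    funext x; rfl
  rw [e]
  exact Complex.reCLM.hasFDerivAt.comp_hasDerivAt x h

/-- **RH-FREE · (K4) for `ζ` when `νω > 2`:** `K_ζ^{ω,ν}` is piecewise `C¹` in the sense of the typed residual
(`IsPiecewiseC1`) — here with NO exceptional points: `K ∈ C¹(ℝ)`, `K′` continuous hence locally integrable
([Su21, Prop. 4.1 (6) and last assertion]). -/
theorem isPiecewiseC1_suzukiKernel {ω : ℝ} (hω : 0 < ω) {ν : ℕ} (h2 : 2 < (ν : ℝ) * ω) :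
    IsPiecewiseC1 (suzukiKernel ω ν) := by
  have h1 : ContDiff ℝ 1 (suzukiKernel ω ν) := by
    have h := contDiff_suzukiKernel hω (ν := ν) (k := 1) (by push_cast; linarith)
    simpa using h
  have hd : Continuous (deriv (suzukiKernel ω ν)) := h1.continuous_deriv le_rfl
  exact ⟨∅, fun a b => by simp, fun x _ => (hasDerivAt_suzukiKernel hω h2 x).differentiableAt,
    hd.continuousOn, hd.locallyIntegrable⟩

/-! ### `ϱ_ζ^{ω,ν} ∈ C^∞(ℝ)` -/

/-- RH-FREE. `E_ζ^{ω,ν}` on the real line decays faster than every power: `‖E(u)‖ ≤ D_m(1+|u|)^{−m}` (`ν ≥ 1`;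
from the strip bound `‖E(u)‖ ≤ De^{−π|u|/8}` of `…XiStrip`). -/
theorem exists_norm_suzukiE_line_le_rpow (ω : ℝ) {ν : ℕ} (hν : 1 ≤ ν) (m : ℕ) :
    ∃ D : ℝ, ∀ u : ℝ, ‖suzukiE ω ν ((u : ℂ) + ((0 : ℝ) : ℂ) * I)‖ ≤ D * (1 + |u|) ^ (-(m : ℝ)) := by
  obtain ⟨D, hD0, hD⟩ := exists_norm_suzukiE_strip_le ω hν 0 0
  refine ⟨D * (m.factorial * (π / 8)⁻¹ ^ m * Real.exp (π / 8)), fun u => ?_⟩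
  have hu : 0 < 1 + |u| := by positivity
  have h1 := hD 0 ⟨le_rfl, le_rfl⟩ u
  have h2 := one_add_abs_pow_mul_exp_neg_le (a := π / 8) (by positivity) m u
  have h3 : Real.exp (-(π / 8) * |u|) ≤
      (m.factorial * (π / 8)⁻¹ ^ m * Real.exp (π / 8)) * (1 + |u|) ^ (-(m : ℝ)) := by
    rw [Real.rpow_neg hu.le, Real.rpow_natCast, le_mul_inv_iff₀ (pow_pos hu m)]
    calc Real.exp (-(π / 8) * |u|) * (1 + |u|) ^ m = (1 + |u|) ^ m * Real.exp (-(π / 8) * |u|) :=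
          mul_comm _ _
      _ ≤ _ := h2
  calc ‖suzukiE ω ν ((u : ℂ) + ((0 : ℝ) : ℂ) * I)‖ ≤ D * Real.exp (-(π / 8) * |u|) := h1
    _ ≤ D * ((m.factorial * (π / 8)⁻¹ ^ m * Real.exp (π / 8)) * (1 + |u|) ^ (-(m : ℝ))) :=
        mul_le_mul_of_nonneg_left h3 hD0
    _ = _ := by ring

/-- RH-FREE. `u ↦ E_ζ^{ω,ν}(u)` is continuous along the real line (`E` is entire). -/
theorem continuous_suzukiE_line (ω : ℝ) (ν : ℕ) :
    Continuous fun u : ℝ => suzukiE ω ν ((u : ℂ) + ((0 : ℝ) : ℂ) * I) :=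
  (differentiable_suzukiE ω ν).continuous.comp (by fun_prop)

/-- **RH-FREE · (K1) for `ζ`, regularity: `ϱ_ζ^{ω,ν} ∈ Cⁿ(ℝ)` for every `n`** (`ν ≥ 1`): `ϱ = Re 𝖥⁻¹E` along the
real line and `E` decays there faster than every power ([Su21, Lemma 4.1]: `E_ζ^{ω,ν}` satisfies (K1)). -/
theorem contDiff_suzukiRho (ω : ℝ) {ν : ℕ} (hν : 1 ≤ ν) (n : ℕ) : ContDiff ℝ n (suzukiRho ω ν) := by
  obtain ⟨D, hD⟩ := exists_norm_suzukiE_line_le_rpow ω hν (n + 2)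
  have h := contDiff_invFourierLine_of_decay (Φ := suzukiE ω ν) (c := 0) le_rfl (continuous_suzukiE_line ω ν)
    hD (n := n) (by push_cast; linarith)
  have e : suzukiRho ω ν = fun x => Complex.reCLM (invFourierLine (suzukiE ω ν) 0 x) := by
    funext x; rfl
  rw [e]
  exact Complex.reCLM.contDiff.comp h

/-- **RH-FREE · `ϱ_ζ^{ω,ν} ∈ C^∞(ℝ)`** (`ν ≥ 1`). -/
theorem contDiff_infty_suzukiRho (ω : ℝ) {ν : ℕ} (hν : 1 ≤ ν) : ContDiff ℝ ((⊤ : ℕ∞) : WithTop ℕ∞) (suzukiRho ω ν) :=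
  contDiff_infty.2 (contDiff_suzukiRho ω hν)

/-- RH-FREE. Derivative formula `ϱ_ζ′(x) = Re (2π)⁻¹∫_ℝ (−iu)E_ζ^{ω,ν}(u)e^{−iux}du` (`ν ≥ 1`). -/
theorem hasDerivAt_suzukiRho (ω : ℝ) {ν : ℕ} (hν : 1 ≤ ν) (x : ℝ) :
    HasDerivAt (suzukiRho ω ν) (invFourierLine (fun z : ℂ => -I * z * suzukiE ω ν z) 0 x).re x := by
  obtain ⟨D, hD⟩ := exists_norm_suzukiE_line_le_rpow ω hν 3
  have h := hasDerivAt_invFourierLine_of_decay (Φ := suzukiE ω ν) (c := 0) le_rfl (continuous_suzukiE_line ω ν)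
    hD (by norm_num) x
  have e : suzukiRho ω ν = fun x => Complex.reCLM (invFourierLine (suzukiE ω ν) 0 x) := by
    funext x; rfl
  rw [e]
  exact Complex.reCLM.hasFDerivAt.comp_hasDerivAt x h

/-! ### Suzuki's Thm. 2.2 canonical system for `ζ`: unconditional on `(−∞,0)`, and on `(0,τ)` MODULO the residual -/

/-- RH-FREE · UNCONDITIONAL. The `ζ` canonical system on `(−∞, 0)`: `∂_t A_ζ = zγB_ζ`, `∂_t B_ζ = −zγ⁻¹A_ζ` with
`γ = 1` there (`E_ζ(t,z) = e^{izt}E_ζ(z)` for `t ≤ 0`; `ω > 0`, `ν ≥ 1`, `νω > 1`). -/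
theorem solvesCanonicalSystemOn_zeta_Iio {ω : ℝ} (hω : 0 < ω) {ν : ℕ} (hν : 1 ≤ ν) (hνω : 1 < (ν : ℝ) * ω) :
    SolvesCanonicalSystemOn (gamma (suzukiKernel ω ν)) (suzukiAt ω ν) (suzukiBt ω ν) (Iio 0) :=
  solvesCanonicalSystemOn_Iio (isSuzukiPair_zeta hω hν hνω)

/-- **RH-FREE · CONDITIONAL (named-fact hypothesis `Suzuki2021_thm31_dynamics`, NOT proved in the tree).** Every
hypothesis of the typed residual holds for the `ζ` data when `ω ≥ ½`, `ν ≥ 1`, `νω > 2`: `IsSuzukiPair`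
(`isSuzukiPair_zeta`), `ϱ_ζ ∈ C¹` (`contDiff_suzukiRho`), (K4) (`isPiecewiseC1_suzukiKernel`) and all windows
clean (`suzuki2021_windows_of_half_le'`, unconditional). HENCE, MODULO that named fact, Suzuki's Thm. 2.2 canonical
system `∂_t A_ζ = zm²B_ζ`, `∂_t B_ζ = −zm⁻²A_ζ` holds on every `(0,τ)` off a locally finite set. This theorem
does not assert the residual; it only shows that nothing ELSE stands between the tree and Thm. 2.2's dynamics. -/
theorem solvesCanonicalSystemOn_zeta_of_thm31 (hfact : Suzuki2021_thm31_dynamics) {ω : ℝ} (hω : 1 / 2 ≤ ω)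
    {ν : ℕ} (hν : 1 ≤ ν) (hνω : 2 < (ν : ℝ) * ω) {τ : ℝ} (hτ : 0 < τ) :
    ∃ D : Set ℝ, (∀ a b : ℝ, (D ∩ Icc a b).Finite) ∧
      SolvesCanonicalSystemOn (gamma (suzukiKernel ω ν)) (suzukiAt ω ν) (suzukiBt ω ν) (Ioo 0 τ \ D) := by
  have h1 : ContDiff ℝ 1 (suzukiRho ω ν) := by simpa using contDiff_suzukiRho ω hν 1
  exact (hfact (suzukiRho ω ν) (suzukiKernel ω ν) τ hτ (isSuzukiPair_zeta (by linarith) hν (by linarith)) h1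
    (isPiecewiseC1_suzukiKernel (by linarith) hνω)
    (fun t ht => suzuki2021_windows_of_half_le' hω hν (by linarith) ht.1)).2.2

end Summit.RiemannHypothesis.RiemannHypothesis.Theorems.SuzukiStructureFunctions
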